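import Summits.QuantumFields.YangMills.Theorems.ParabolicTrajectoryLatticeGapOnTrajectorySlabClusteringTorusKernels
import Summits.QuantumFields.YangMills.Theorems.ParabolicTrajectoryLatticeGapOnTrajectorySlabClusteringGeometry
import Summits.QuantumFields.YangMills.Theorems.ParabolicTrajectoryLatticeGapOnTrajectorySlabClusteringOS
import HarnessLib

/-!
# Crux `LatticeGapOnTrajectory` (stmt-QuantumFields-10523), line `orbit-kantorovich-finite-size`:
# slab clustering — one torus, far case (helper file for the stub `stub_slabClustering`)

From the orbit–Kantorovich windows along the scheme (with the polynomial clause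
`|β_k| α_k ≤ K₀ a_k^{−p₀}`) and the landed engine package (`KREngine`, `TorusFramesExist`,
`SpecificationTower`, `WilsonTorusDLR`): eventually in `k`, for every bounded measurable SLAB
observable `X` (links based at lattice times `1 … w`) on the torus of side `2L_k+1` and every
separation `N` with `N + 2w ≤ L_k`,
`‖osCorr μ_k Θ₀ τ_N X X‖ ≤ K (a_k⁻¹ (w+1)(L_k+1))^p B² e^{−Δ a_k N}`, `Δ = κ(n₀,γ₀,1)/t`.

* §1 One torus, far case (`3b ≤ N`): uniform frames of scale `b` (time origin `−(w+1+2b)`), the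
  two regions `Λ_F` (labels `[2, 2+w/b]`, containing the reflected slab) and `Λ_G` (labels
  `[g₁, g₂]`, containing the shifted slab), FINITE RANGE of the region averages (adjacent label
  layers, `dependsOn_windowAvg_interval`), their TV-LIPSCHITZ bounds in the orbit weight
  (`abs_windowAvg_sub_le_orbitWeight_frame`) with the constant `δ = 2B(1 + 2e²|β|α·7680 b⁴)` on all
  cells, the two-region tower identity + engine (`abs_corr_le_of_layers`) at coarse distance
  `N/b − 3`: `|cov(f, g)| ≤ C₀ ((K+1)⁴ δ)² e^{−κ(N/b − 3)}` (`abs_cov_slab_le_far`), and the complex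
  form for `osCorr` (`norm_osCorr_le_far`, four real covariances).
* The stub itself (eventualities in `k`, near case, polynomial bookkeeping) is in
  `…StubSlabClustering.lean`, which imports this file.
-/

namespace Summit.QuantumFields.YangMills.Cruxes.LatticeGapOnTrajectory.OrbitKantorovichFiniteSize

open scoped BigOperators ComplexConjugate ENNReal ProbabilityTheory
open Filter MeasureTheory
open Literature.Probability.LatticeModels (Specification IsSpecification IsGibbsMeasure glueWith)
open Literature.MathematicalPhysics.QuantumLattice
open Literature.MathematicalPhysics.QuantumFieldTheory

noncomputable section

namespace SlabClustering

section OneTorus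

variable {G : Type} [Group G] [TopologicalSpace G] [IsTopologicalGroup G] [CompactSpace G]
  [MeasurableSpace G] [BorelSpace G] (r : LatticeRep G)

/-- **Finite range of a region average, in labels.** For the region `Λ` of the links whose time
label (uniform frame of scale `b`, origin `o`) lies in `[lo, hi]` with `1 ≤ lo`, `hi + 1 ≤ K`, and
`f` reading only `Λ`, the average `γ_Λ f` of Wilson's torus specification reads the boundary
condition only on the links with time label `lo − 1` or `hi + 1` (plaquettes span one time step,
one time step changes the label by at most one). -/
theorem dependsOn_windowAvg_interval {L b K : ℕ} (hb : 0 < b) (hK : K + 1 = (2 * L + 1) / b)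
    (o : ZMod (2 * L + 1)) (β : ℝ) {lo hi : ℕ} (hlo : 1 ≤ lo) (hhi : hi + 1 ≤ K)
    {f : GaugeConfig 4 (2 * L + 1) G → ℝ} (hf : Measurable f)
    (hfdep : DependsOn f (↑(Finset.univ.filter fun e : Edge 4 (2 * L + 1) =>
      lo ≤ StubTorusFrames.ulabel b K (e.1 0 - o).val ∧
        StubTorusFrames.ulabel b K (e.1 0 - o).val ≤ hi) : Set (Edge 4 (2 * L + 1)))) :
    DependsOn (windowAvg (torusYM r.ρ β (2 * L + 1)) (Finset.univ.filter fun e : Edge 4 (2 * L + 1) =>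
      lo ≤ StubTorusFrames.ulabel b K (e.1 0 - o).val ∧
        StubTorusFrames.ulabel b K (e.1 0 - o).val ≤ hi) f)
      {e : Edge 4 (2 * L + 1) | StubTorusFrames.ulabel b K (e.1 0 - o).val = lo - 1 ∨
        StubTorusFrames.ulabel b K (e.1 0 - o).val = hi + 1} := by
  classical
  refine dependsOn_windowAvg_torusYM r β _ (fun p hp => ?_) hf hfdep
  obtain ⟨e, he, hx⟩ := edgeShadow_time hp
  have ht := (Finset.mem_filter.1 he).2
  have hnb := ulabel_neighbours hb hK o (e.1 0) hlo hhi ht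
  have key : ∀ y : Site 4 (2 * L + 1), (y 0 = p.1 0 ∨ y 0 = p.1 0 + 1) →
      lo - 1 ≤ StubTorusFrames.ulabel b K (y 0 - o).val ∧
        StubTorusFrames.ulabel b K (y 0 - o).val ≤ hi + 1 := by
    intro y hy
    rcases hx with hx | hx <;> rcases hy with hy | hy
    · rw [hy, hx]; exact ⟨by omega, by omega⟩
    · rw [hy, hx]; exact hnb.1
    · rw [hy, hx]; exact hnb.2
    · rw [hy, hx, sub_add_cancel]; exact ⟨by omega, by omega⟩
  have mem : ∀ e' : Edge 4 (2 * L + 1), (e'.1 0 = p.1 0 ∨ e'.1 0 = p.1 0 + 1) →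
      e' ∈ (Finset.univ.filter fun e : Edge 4 (2 * L + 1) =>
        lo ≤ StubTorusFrames.ulabel b K (e.1 0 - o).val ∧
          StubTorusFrames.ulabel b K (e.1 0 - o).val ≤ hi) ∨
      e' ∈ {e : Edge 4 (2 * L + 1) | StubTorusFrames.ulabel b K (e.1 0 - o).val = lo - 1 ∨
        StubTorusFrames.ulabel b K (e.1 0 - o).val = hi + 1} := by
    intro e' he'
    obtain ⟨h1, h2⟩ := key e'.1 he'
    by_cases hin : lo ≤ StubTorusFrames.ulabel b K (e'.1 0 - o).val ∧
        StubTorusFrames.ulabel b K (e'.1 0 - o).val ≤ hi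
    · exact Or.inl (Finset.mem_filter.2 ⟨Finset.mem_univ _, hin⟩)
    · right
      show StubTorusFrames.ulabel b K (e'.1 0 - o).val = lo - 1 ∨
        StubTorusFrames.ulabel b K (e'.1 0 - o).val = hi + 1
      omega
  exact ⟨mem _ (Or.inl rfl), mem _ (shift_time p.1 _), mem _ (shift_time p.1 _), mem _ (Or.inl rfl)⟩

/-- **One torus, far case.** On the torus of side `2L+1` at coupling `β`, with uniform frames of
scale `b` (`K + 1 = (2L+1)/b ≥ 2n₀+3` cells per axis, `4b ≤ L`), two bounded measurable real
observables `f` (reading the links based at times `≥ 2L − w`) and `g` (times `N+1 … N+w`),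
`N + 2w ≤ L`, `3b ≤ N`, and the KR window package for every family of frames of scale `b`:
`|∫ f g − ∫ f ∫ g| ≤ C₀ ((K+1)⁴ δ)² e^{−κ(N/b − 3)}`, `δ = 2B(1 + 2e²|β|α·7680 b⁴)`
(regions `Λ_F ⊇ supp f`, `Λ_G ⊇ supp g` = label intervals; finite range; TV-Lipschitz bounds on
the adjacent layers, `0` elsewhere; two-region tower identity; engine). -/
theorem abs_cov_slab_le_far (hT : SpecificationTower) {n₀ : ℕ} {γ₀ κ C₀ : ℝ} (hC₀ : 0 ≤ C₀)
    (hEng : ∀ (μ : Fin 4 → ℕ) (V S : Type) [Fintype V] [MeasurableSpace S]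
      (cell : V → CoarseIdx μ) (w : CoarseIdx μ → (V → S) → (V → S) → ℝ)
      (γ : Specification V S) (k : CoarseIdx μ → CoarseIdx μ → CoarseIdx μ → ℝ),
      (∀ i, 2 * n₀ + 3 ≤ μ i + 1) → IsSpecification γ → IsKRWindow cell w γ 1 n₀ γ₀ k →
      ∀ ν : Measure (V → S), IsGibbsMeasure γ ν →
      ∀ (f g : (V → S) → ℝ) (Δf Δg : Finset (CoarseIdx μ)) (δf δg : CoarseIdx μ → ℝ) (D : ℕ),
        Measurable f → Measurable g → (∃ B, ∀ σ, |f σ| ≤ B) → (∃ B, ∀ σ, |g σ| ≤ B) →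
        DependsOn f {v | cell v ∈ Δf} → DependsOn g {v | cell v ∈ Δg} →
        IsCellLipBound cell w f δf → IsCellLipBound cell w g δg →
        (∀ x ∈ Δf, ∀ y ∈ Δg, D ≤ cdist x y) →
          |cov[f, g; ν]| ≤ C₀ * (∑ x ∈ Δf, δf x) * (∑ y ∈ Δg, δg y) * Real.exp (-(κ * D)))
    (β α : ℝ) (hα : 0 < α) {L b K w N : ℕ} (hb : 0 < b) (hK : K + 1 = (2 * L + 1) / b)
    (hbL : 4 * b ≤ L) (hNw : N + 2 * w ≤ L) (hN : 3 * b ≤ N) (hn₀ : 2 * n₀ + 3 ≤ K + 1)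
    (hγ : IsSpecification (torusYM r.ρ β (2 * L + 1)))
    (hGibbs : IsGibbsMeasure (torusYM r.ρ β (2 * L + 1)) (wilsonMeasure (d := 4) (L := 2 * L + 1) r.ρ β))
    (hphys : ∀ (μ : Fin 4 → ℕ) (q : (i : Fin 4) → ZMod (2 * L + 1) → ZMod (μ i + 1)),
        (∀ i, 2 * n₀ + 3 ≤ μ i + 1) → (∀ i, IsTorusFrame (2 * L + 1) b (q i)) →
          ∃ kp : CoarseIdx μ → CoarseIdx μ → CoarseIdx μ → ℝ,
            IsKRWindow (cellOf q) (orbitWeight r α q) (torusYM r.ρ β (2 * L + 1)) 1 n₀ γ₀ kp)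
    {f g : GaugeConfig 4 (2 * L + 1) G → ℝ} {B : ℝ} (hfm : Measurable f) (hgm : Measurable g)
    (hfb : ∀ U, |f U| ≤ B) (hgb : ∀ U, |g U| ≤ B)
    (hfdep : DependsOn f {e : Edge 4 (2 * L + 1) | 2 * L - w ≤ (e.1 0).val})
    (hgdep : DependsOn g {e : Edge 4 (2 * L + 1) | 1 + N ≤ (e.1 0).val ∧ (e.1 0).val ≤ w + N}) :
    |(∫ U, f U * g U ∂(wilsonMeasure (d := 4) (L := 2 * L + 1) r.ρ β)) -
        (∫ U, f U ∂(wilsonMeasure (d := 4) (L := 2 * L + 1) r.ρ β)) *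
          ∫ U, g U ∂(wilsonMeasure (d := 4) (L := 2 * L + 1) r.ρ β)| ≤
      C₀ * ((K + 1 : ℝ) ^ 4 * (2 * B * (1 + 2 * Real.exp 2 * |β| * α * (7680 * (b : ℝ) ^ 4)))) ^ 2 *
        Real.exp (-(κ * (N / b - 3 : ℕ))) := by
  classical
  -- the frames: uniform frames of scale `b`, time origin `o`
  set o : ZMod (2 * L + 1) := -(((w + 1 + 2 * b : ℕ) : ZMod (2 * L + 1))) with ho
  set μ : Fin 4 → ℕ := fun _ => K with hμdef
  set q : (i : Fin 4) → ZMod (2 * L + 1) → ZMod (μ i + 1) :=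
    fun i => StubTorusFrames.uframe (2 * L + 1) b K (if i = 0 then o else 0) with hqdef
  have hframe : ∀ i, IsTorusFrame (2 * L + 1) b (q i) := fun i =>
    ⟨StubTorusFrames.uframe_step hb hK _, StubTorusFrames.uframe_fibre hb hK _⟩
  obtain ⟨kp, hKR⟩ := hphys μ q (fun _ => hn₀) hframe
  have hcell : ∀ e : Edge 4 (2 * L + 1),
      cellOf q e 0 = ((StubTorusFrames.ulabel b K (e.1 0 - o).val : ℕ) : ZMod (μ 0 + 1)) := fun e => by
    simp [cellOf, siteCell, hqdef, StubTorusFrames.uframe]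
  obtain ⟨hapart, hg₂K, hpairs⟩ := slab_labels_apart hb hK hbL hNw hN
  have hg12 : (N + w + 2) / b ≤ (N + 2 * w + 1) / b + 1 := by
    rw [← Nat.add_div_right _ hb]; exact Nat.div_le_div_right (by omega)
  have hwL : w ≤ L := by omega
  -- the label data as opaque naturals (for `omega`)
  have hneg := fun (z : ZMod (2 * L + 1)) (hz : 2 * L - w ≤ z.val) => label_negSlab hb hK hbL hwL z hz
  have hpos := fun (z : ZMod (2 * L + 1)) (hz1 : N + 1 ≤ z.val) (hz2 : z.val ≤ N + w) =>
    label_posSlab hb hK hbL hNw z hz1 hz2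
  set wb := w / b with hwb
  set g₁ := (N + w + 2) / b with hg₁
  set g₂ := (N + 2 * w + 1) / b with hg₂
  set nb := N / b with hnb
  clear_value wb g₁ g₂ nb
  have F1 : 2 + wb + 1 ≤ K := by omega
  have F5 : g₁ + 2 - 1 ≤ K := by omega
  -- regions and layers
  set ΛF : Finset (Edge 4 (2 * L + 1)) := Finset.univ.filter fun e : Edge 4 (2 * L + 1) =>
    2 ≤ StubTorusFrames.ulabel b K (e.1 0 - o).val ∧
      StubTorusFrames.ulabel b K (e.1 0 - o).val ≤ 2 + wb with hΛF
  set ΛG : Finset (Edge 4 (2 * L + 1)) := Finset.univ.filter fun e : Edge 4 (2 * L + 1) =>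
    g₁ + 2 ≤ StubTorusFrames.ulabel b K (e.1 0 - o).val ∧
      StubTorusFrames.ulabel b K (e.1 0 - o).val ≤ g₂ + 2 with hΛG
  set ΔF : Finset (CoarseIdx μ) := Finset.univ.filter fun c : CoarseIdx μ =>
    c 0 = ((2 - 1 : ℕ) : ZMod (μ 0 + 1)) ∨ c 0 = ((2 + wb + 1 : ℕ) : ZMod (μ 0 + 1)) with hΔF
  set ΔG : Finset (CoarseIdx μ) := Finset.univ.filter fun c : CoarseIdx μ =>
    c 0 = ((g₁ + 2 - 1 : ℕ) : ZMod (μ 0 + 1)) ∨ c 0 = ((g₂ + 2 + 1 : ℕ) : ZMod (μ 0 + 1)) with hΔG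
  -- supports
  have hfΛ : DependsOn f (↑ΛF : Set (Edge 4 (2 * L + 1))) := hfdep.mono fun e he =>
    Finset.mem_coe.2 (Finset.mem_filter.2 ⟨Finset.mem_univ _, hneg (e.1 0) he⟩)
  have hgΛ : DependsOn g (↑ΛG : Set (Edge 4 (2 * L + 1))) := hgdep.mono fun e he =>
    Finset.mem_coe.2 (Finset.mem_filter.2 ⟨Finset.mem_univ _,
      hpos (e.1 0) (by have := he.1; omega) (by have := he.2; omega)⟩)
  have hdisj : Disjoint ΛF ΛG := by
    rw [Finset.disjoint_left]
    intro e h1 h2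
    have a := (Finset.mem_filter.1 h1).2
    have a' := (Finset.mem_filter.1 h2).2
    omega
  -- finite range of the two region averages
  have hFRF := dependsOn_windowAvg_interval r hb hK o β (lo := 2) (hi := 2 + wb) (by norm_num)
    F1 hfm hfΛ
  have hFRG := dependsOn_windowAvg_interval r hb hK o β (lo := g₁ + 2) (hi := g₂ + 2)
    (by omega) hg₂K hgm hgΛ
  have hFh : DependsOn (windowAvg (torusYM r.ρ β (2 * L + 1)) ΛF f) {v | cellOf q v ∈ ΔF} :=
    hFRF.mono fun e he => by
      show cellOf q e ∈ ΔF
      refine Finset.mem_filter.2 ⟨Finset.mem_univ _, ?_⟩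
      rw [hcell e]
      rcases he with h | h
      · left; rw [h]
      · right; rw [h]
  have hGh : DependsOn (windowAvg (torusYM r.ρ β (2 * L + 1)) ΛG g) {v | cellOf q v ∈ ΔG} :=
    hFRG.mono fun e he => by
      show cellOf q e ∈ ΔG
      refine Finset.mem_filter.2 ⟨Finset.mem_univ _, ?_⟩
      rw [hcell e]
      rcases he with h | h
      · left; rw [h]
      · right; rw [h]
  have hΔFG : ∀ v ∈ ΛG, cellOf q v ∉ ΔF := fun v hv hΔ => by
    have hl := (Finset.mem_filter.1 hv).2
    have hΔ' := (Finset.mem_filter.1 hΔ).2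
    rw [hcell v] at hΔ'
    have hK1 : StubTorusFrames.ulabel b K (v.1 0 - o).val ≤ K := ulabel_le _
    rcases hΔ' with h | h
    · have := natCast_inj_of_le hK1 (by omega) h; omega
    · have := natCast_inj_of_le hK1 (by omega) h; omega
  -- the Lipschitz bounds: TV-Lipschitz on the adjacent layers, finite range elsewhere
  set δ : ℝ := 2 * B * (1 + 2 * Real.exp 2 * |β| * α * (7680 * (b : ℝ) ^ 4)) with hδ
  have hB : 0 ≤ B := (abs_nonneg _).trans (hfb fun _ => 1)
  have hδ0 : 0 ≤ δ := by positivity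
  have hw0 : ∀ c σ τ, 0 ≤ orbitWeight r α q c σ τ := fun c σ τ =>
    le_min zero_le_one (div_nonneg (cellDev_nonneg r q c σ τ) hα.le)
  have hLip : ∀ {lo hi : ℕ} {h : GaugeConfig 4 (2 * L + 1) G → ℝ}, 1 ≤ lo → lo ≤ K + 1 → hi + 1 ≤ K →
      Measurable h → (∀ U, |h U| ≤ B) →
      DependsOn h (↑(Finset.univ.filter fun e : Edge 4 (2 * L + 1) =>
        lo ≤ StubTorusFrames.ulabel b K (e.1 0 - o).val ∧
          StubTorusFrames.ulabel b K (e.1 0 - o).val ≤ hi) : Set (Edge 4 (2 * L + 1))) →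
      IsCellLipBound (cellOf q) (orbitWeight r α q)
        (windowAvg (torusYM r.ρ β (2 * L + 1)) (Finset.univ.filter fun e : Edge 4 (2 * L + 1) =>
          lo ≤ StubTorusFrames.ulabel b K (e.1 0 - o).val ∧
            StubTorusFrames.ulabel b K (e.1 0 - o).val ≤ hi) h) (fun _ => δ) := by
    intro lo hi h hlo hloK hhi hhm hhb hhdep
    have hFR := dependsOn_windowAvg_interval r hb hK o β hlo hhi hhm hhdep
    refine ⟨fun _ => hδ0, fun c σ τ hστ => ?_⟩
    by_cases hc : c 0 = ((lo - 1 : ℕ) : ZMod (μ 0 + 1)) ∨ c 0 = ((hi + 1 : ℕ) : ZMod (μ 0 + 1))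
    · refine abs_windowAvg_sub_le_orbitWeight_frame r β α hα q hframe _ c (fun e he heq => ?_)
        hhm hhdep hhb σ τ hστ
      have hl := (Finset.mem_filter.1 he).2
      have h0 : cellOf q e 0 = c 0 := by rw [heq]
      rw [hcell e] at h0
      have hK1 : StubTorusFrames.ulabel b K (e.1 0 - o).val ≤ K := ulabel_le _
      rcases hc with hc | hc <;> rw [hc] at h0
      · have := natCast_inj_of_le hK1 (by omega) h0; omega
      · have := natCast_inj_of_le hK1 (by omega) h0; omega
    · have heq : windowAvg (torusYM r.ρ β (2 * L + 1)) _ h σ =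
          windowAvg (torusYM r.ρ β (2 * L + 1)) _ h τ :=
        hFR fun e he => hστ e fun hce => hc (by
          rw [← hce, hcell e]
          rcases he with h' | h'
          · left; rw [h']
          · right; rw [h'])
      rw [heq, sub_self, abs_zero]
      exact mul_nonneg hδ0 (hw0 c σ τ)
  have hLipF := hLip (lo := 2) (hi := 2 + wb) (by norm_num) (by omega) F1 hfm hfb hfΛ
  have hLipG := hLip (lo := g₁ + 2) (hi := g₂ + 2) (by omega) (by omega) hg₂K hgm hgb hgΛ
  -- separation of the layers
  have hD : ∀ x ∈ ΔF, ∀ y ∈ ΔG, nb - 3 ≤ cdist x y := by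
    intro x hx y hy
    have hx' := (Finset.mem_filter.1 hx).2
    have hy' := (Finset.mem_filter.1 hy).2
    rcases hx' with hx' | hx' <;> rcases hy' with hy' | hy'
    · obtain ⟨h12, hD1, hD2⟩ := hpairs _ _ (Or.inl rfl) (Or.inl rfl)
      exact le_cdist_of_labels (μ := μ) rfl x y hx' hy' h12 (by omega) hD1 hD2
    · obtain ⟨h12, hD1, hD2⟩ := hpairs _ _ (Or.inl rfl) (Or.inr rfl)
      exact le_cdist_of_labels (μ := μ) rfl x y hx' hy' h12 (by omega) hD1 hD2
    · obtain ⟨h12, hD1, hD2⟩ := hpairs _ _ (Or.inr rfl) (Or.inl rfl)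
      exact le_cdist_of_labels (μ := μ) rfl x y hx' hy' h12 (by omega) hD1 hD2
    · obtain ⟨h12, hD1, hD2⟩ := hpairs _ _ (Or.inr rfl) (Or.inr rfl)
      exact le_cdist_of_labels (μ := μ) rfl x y hx' hy' h12 (by omega) hD1 hD2
  -- the two-region tower identity and the engine
  have hmain := abs_corr_le_of_layers (μ := μ) hT hEng (cellOf q) (orbitWeight r α q)
    (torusYM r.ρ β (2 * L + 1)) kp (fun _ => hn₀) hγ hKR _ hGibbs hfm hgm hfb hgb ΛF ΛG hgΛ hdisj
    ΔF ΔG hFh hGh hΔFG hLipF hLipG (nb - 3) hD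
  refine hmain.trans ?_
  have hcard : ∀ Δ : Finset (CoarseIdx μ), (Δ.card : ℝ) ≤ ((K : ℝ) + 1) ^ 4 := fun Δ => by
    have h1 : Δ.card ≤ Fintype.card (CoarseIdx μ) := Finset.card_le_univ Δ
    have h2 : Fintype.card (CoarseIdx μ) = (K + 1) ^ 4 := by
      simp [CoarseIdx, Fintype.card_pi, ZMod.card, hμdef, Finset.prod_const, Finset.card_univ]
    rw [h2] at h1
    exact_mod_cast h1
  calc C₀ * (ΔF.card * δ) * (ΔG.card * δ) * Real.exp (-(κ * (nb - 3 : ℕ)))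
      ≤ C₀ * (((K : ℝ) + 1) ^ 4 * δ) * (((K : ℝ) + 1) ^ 4 * δ) * Real.exp (-(κ * (nb - 3 : ℕ))) := by
        gcongr
        · exact hcard ΔF
        · exact hcard ΔG
    _ = _ := by ring

/-- **One torus, far case, for the reflected autocorrelation.** Under the hypotheses of
`abs_cov_slab_le_far`, for a bounded measurable complex slab observable `X` (links based at
lattice times `1 … w`): `‖osCorr μ Θ₀ τ_N X X‖ ≤ 4 C₀ ((K+1)⁴ δ)² e^{−κ(N/b−3)}` — `osCorr` is the
complex covariance of `conj X∘Θ₀` (supported at times `≥ 2L − w`) and `X∘τ_N` (times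
`N+1 … N+w`), i.e. four real covariances of slab observables. -/
theorem norm_osCorr_le_far (hT : SpecificationTower) {n₀ : ℕ} {γ₀ κ C₀ : ℝ} (hC₀ : 0 ≤ C₀)
    (hEng : ∀ (μ : Fin 4 → ℕ) (V S : Type) [Fintype V] [MeasurableSpace S]
      (cell : V → CoarseIdx μ) (w : CoarseIdx μ → (V → S) → (V → S) → ℝ)
      (γ : Specification V S) (k : CoarseIdx μ → CoarseIdx μ → CoarseIdx μ → ℝ),
      (∀ i, 2 * n₀ + 3 ≤ μ i + 1) → IsSpecification γ → IsKRWindow cell w γ 1 n₀ γ₀ k →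
      ∀ ν : Measure (V → S), IsGibbsMeasure γ ν →
      ∀ (f g : (V → S) → ℝ) (Δf Δg : Finset (CoarseIdx μ)) (δf δg : CoarseIdx μ → ℝ) (D : ℕ),
        Measurable f → Measurable g → (∃ B, ∀ σ, |f σ| ≤ B) → (∃ B, ∀ σ, |g σ| ≤ B) →
        DependsOn f {v | cell v ∈ Δf} → DependsOn g {v | cell v ∈ Δg} →
        IsCellLipBound cell w f δf → IsCellLipBound cell w g δg →
        (∀ x ∈ Δf, ∀ y ∈ Δg, D ≤ cdist x y) →
          |cov[f, g; ν]| ≤ C₀ * (∑ x ∈ Δf, δf x) * (∑ y ∈ Δg, δg y) * Real.exp (-(κ * D)))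
    (β α : ℝ) (hα : 0 < α) {L b K w N : ℕ} (hb : 0 < b) (hK : K + 1 = (2 * L + 1) / b)
    (hbL : 4 * b ≤ L) (hNw : N + 2 * w ≤ L) (hN : 3 * b ≤ N) (hn₀ : 2 * n₀ + 3 ≤ K + 1)
    (hγ : IsSpecification (torusYM r.ρ β (2 * L + 1)))
    (hGibbs : IsGibbsMeasure (torusYM r.ρ β (2 * L + 1)) (wilsonMeasure (d := 4) (L := 2 * L + 1) r.ρ β))
    (hphys : ∀ (μ : Fin 4 → ℕ) (q : (i : Fin 4) → ZMod (2 * L + 1) → ZMod (μ i + 1)),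
        (∀ i, 2 * n₀ + 3 ≤ μ i + 1) → (∀ i, IsTorusFrame (2 * L + 1) b (q i)) →
          ∃ kp : CoarseIdx μ → CoarseIdx μ → CoarseIdx μ → ℝ,
            IsKRWindow (cellOf q) (orbitWeight r α q) (torusYM r.ρ β (2 * L + 1)) 1 n₀ γ₀ kp)
    {X : GaugeConfig 4 (2 * L + 1) G → ℂ} {B : ℝ} (hXm : Measurable X) (hXb : ∀ U, ‖X U‖ ≤ B)
    (hXdep : DependsOn X {e : Edge 4 (2 * L + 1) | 1 ≤ (e.1 0).val ∧ (e.1 0).val ≤ w}) :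
    ‖osCorr (wilsonMeasure (d := 4) (L := 2 * L + 1) r.ρ β) GaugeConfig.negReflect
        (torusTimeShift (2 * L + 1) N) X X‖ ≤
      4 * (C₀ * ((K + 1 : ℝ) ^ 4 * (2 * B * (1 + 2 * Real.exp 2 * |β| * α * (7680 * (b : ℝ) ^ 4)))) ^ 2 *
        Real.exp (-(κ * (N / b - 3 : ℕ)))) := by
  haveI : IsProbabilityMeasure (wilsonMeasure (d := 4) (L := 2 * L + 1) r.ρ β) := hGibbs.1
  rw [osCorr_negReflect_eq_cov r.ρ r.continuous β N hXm]
  set F : GaugeConfig 4 (2 * L + 1) G → ℂ := fun U => conj (X (GaugeConfig.negReflect U)) with hF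
  set Gc : GaugeConfig 4 (2 * L + 1) G → ℂ := fun U => X (torusTimeShift (2 * L + 1) N U) with hGc
  have hFm : Measurable F :=
    Complex.continuous_conj.measurable.comp (hXm.comp WilsonSiteRP.measurable_negReflect)
  have hGm : Measurable Gc := hXm.comp (torusTimeShift (2 * L + 1) N).measurable
  have hFb : ∀ U, ‖F U‖ ≤ B := fun U => by simp only [hF, RCLike.norm_conj]; exact hXb _
  have hGb : ∀ U, ‖Gc U‖ ≤ B := fun U => hXb _
  have hFdep : DependsOn F {e : Edge 4 (2 * L + 1) | 2 * L - w ≤ (e.1 0).val} := fun U V h =>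
    congrArg (starRingEnd ℂ) (dependsOn_comp_negReflect_slab (by omega) hXdep h)
  have hGdep : DependsOn Gc {e : Edge 4 (2 * L + 1) | 1 + N ≤ (e.1 0).val ∧ (e.1 0).val ≤ w + N} :=
    Transfer.Hankel.dependsOn_comp_torusTimeShift hXdep N (by omega)
  have dre : ∀ {H : GaugeConfig 4 (2 * L + 1) G → ℂ} {s : Set (Edge 4 (2 * L + 1))},
      DependsOn H s → DependsOn (fun U => (H U).re) s := fun hH U V hUV =>
    congrArg Complex.re (hH hUV)
  have dim : ∀ {H : GaugeConfig 4 (2 * L + 1) G → ℂ} {s : Set (Edge 4 (2 * L + 1))},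
      DependsOn H s → DependsOn (fun U => (H U).im) s := fun hH U V hUV =>
    congrArg Complex.im (hH hUV)
  have bre : ∀ {H : GaugeConfig 4 (2 * L + 1) G → ℂ}, (∀ U, ‖H U‖ ≤ B) → ∀ U, |(H U).re| ≤ B :=
    fun hH U => (Complex.abs_re_le_norm _).trans (hH U)
  have bim : ∀ {H : GaugeConfig 4 (2 * L + 1) G → ℂ}, (∀ U, ‖H U‖ ≤ B) → ∀ U, |(H U).im| ≤ B :=
    fun hH U => (Complex.abs_im_le_norm _).trans (hH U)
  refine norm_cov_complex_le _ hFm hGm hFb hGb ?_ ?_ ?_ ?_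
  · exact abs_cov_slab_le_far r hT hC₀ hEng β α hα hb hK hbL hNw hN hn₀ hγ hGibbs hphys
      (Complex.measurable_re.comp hFm) (Complex.measurable_re.comp hGm) (bre hFb) (bre hGb)
      (dre hFdep) (dre hGdep)
  · exact abs_cov_slab_le_far r hT hC₀ hEng β α hα hb hK hbL hNw hN hn₀ hγ hGibbs hphys
      (Complex.measurable_im.comp hFm) (Complex.measurable_im.comp hGm) (bim hFb) (bim hGb)
      (dim hFdep) (dim hGdep)
  · exact abs_cov_slab_le_far r hT hC₀ hEng β α hα hb hK hbL hNw hN hn₀ hγ hGibbs hphys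
      (Complex.measurable_re.comp hFm) (Complex.measurable_im.comp hGm) (bre hFb) (bim hGb)
      (dre hFdep) (dim hGdep)
  · exact abs_cov_slab_le_far r hT hC₀ hEng β α hα hb hK hbL hNw hN hn₀ hγ hGibbs hphys
      (Complex.measurable_im.comp hFm) (Complex.measurable_re.comp hGm) (bim hFb) (bre hGb)
      (dim hFdep) (dre hGdep)

end OneTorus

end SlabClustering

end

end Summit.QuantumFields.YangMills.Cruxes.LatticeGapOnTrajectory.OrbitKantorovichFiniteSize
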